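import Summits.MatrixMultiplication.MatrixMultiplication.Theorems.SoloInformedCwTwoCayleyCensus
import Summits.MatrixMultiplication.MatrixMultiplication.Theorems.SoloInformedCwTwoShadowCharTwoIff
import Summits.MatrixMultiplication.MatrixMultiplication.Theorems.SoloInformedCwTwoCharTwoRestrictions
import HarnessLib

/-!
# `P ⊵ N_k` over every field: the complete table (solo-informed, gen 26)

Third file of generation 26.  The every-field table of the §2n census so far: `P ⊵ N_k ⟺ (2 : K) ≠ 0`
for `k ∈ {6, 7, 10, 12, 14, 15, 16, 22}` (`SoloInformedCwTwoShadowCharTwoIff`) and for `k = 9`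
(`SoloInformedCwTwoCayleyCensus`, the Cayley form modulo `2`).  Here `N₁₁` and `N₁₃` join, by
replacing their landed certificates (multipliers `12`, `12`) with `2`-power chains:
* `N₁₁`: `P ⊵ T₂` (multiplier `2`, `SoloInformedCwTwoShadow`), transported along the cyclic
  permutation of the three factors (`polyDegeneratesTo_cyc`; `P` is fully symmetric), then the
  multiplier-`2` isomorphism `T₂^{(231)} ≅ N₁₁` of `SoloInformedCwTwoClassReps`;
* `N₁₃`: `P ⊵ N₁₀` (multiplier `4`) and the ORDER-ZERO toric degeneration `N₁₀ ⊵ N₁₃`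
  (`N₁₃ = N₁₀ ∖ {e₂₀₀}`; weight `x₂ ↦ ε x₂`), multiplier `1`, valid over every commutative ring.
* `N₁₈`: `P ⊵ N₉` (multiplier `4`, iff `2 ≠ 0` by the Cayley form) and the RESTRICTION `N₉ ⊵ N₁₈`
  (order `0`, multiplier `1`, every commutative ring): `N₉ = Σᵢ ℓᵢ ⊗ eᵢ ⊗ eᵢ` with
  `(ℓ₀, ℓ₁, ℓ₂) = (x₀, x₀ + x₁, x₁)` is the generic `2 × 3 × 3` pencil, and
  `N₁₈ = x₀ ⊗ (e₀e₀ + e₁e₁) + x₁ ⊗ (e₀e₁ + e₁e₂) = ℓ₀ ⊗ e₀(e₀ - e₁) + ℓ₁ ⊗ (e₀ + e₁)e₁ + ℓ₂ ⊗ e₁(e₂ - e₁)`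
  — this replaces the multiplier-`250` certificate, so characteristic `5` is no exception.
* `N₃, N₅, N₈` (landed multipliers `48, 24, 6`, all through the limit `L`, which collapses modulo `3`):
  NEW MONOMIAL toric certificates found by a targeted constraint search (weights chosen so that the
  normal form's support is a level set, the lower cells forced to vanish): `P ⊵ 2·N₃` at order `1`,
  `P ⊵ 2·N₅` at order `2`, and `N₅ ⊵ N₈` at order `2` with multiplier `1` (every commutative ring).
Result (`sThree_polyDegeneratesTo_nurmiev_iff`): over a field `K` and for `1 ≤ k ≤ 24`,
`P ⊵ N_k ⟺ (k ∉ {1, 2, 4}) ∧ (char K ≠ 2 ∨ k ∈ {17, 19, 20, 21, 23, 24})` — the prime `2` is the only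
exceptional characteristic of the degeneration census of the door tensor, and fifteen of the
twenty-one boundary classes are lost there.
Sources: [cite: Nurmiev2000, Table 2]; degeneration certificates [cite: Alman2021, §2.4].
Everything here is PROVED; no new axioms.
-/

namespace Summit.MatrixMultiplication.MatrixMultiplication.Theorems

open Literature.Computability.AlgebraicComplexity
open Literature.Barriers.MatrixMultiplication (PolyDegeneratesTo)

/-- Degeneration is transported along the cyclic permutation `(a, b, c) ↦ (b, c, a)` of the factors.
[cite: Alman2021, §2.4] -/
theorem polyDegeneratesTo_cyc {K : Type*} [CommRing K] {ι κ μ ι' κ' μ' : Type*}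
    [Fintype ι] [Fintype κ] [Fintype μ] {t : ι → κ → μ → K} {s : ι' → κ' → μ' → K}
    (hts : PolyDegeneratesTo t s) :
    PolyDegeneratesTo (fun a b c => t b c a) (fun a b c => s b c a) := by
  obtain ⟨h, A, B, C, hd⟩ := hts
  refine ⟨h, C, A, B, fun a' b' c' j hj => ?_⟩
  have key : (∑ x, ∑ y, ∑ z, Polynomial.C (t y z x) * (C x a' * A y b' * B z c')) =
      ∑ a, ∑ b, ∑ c, Polynomial.C (t a b c) * (A a b' * B b c' * C c a') := by
    rw [Finset.sum_comm]
    refine Finset.sum_congr rfl fun a _ => ?_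
    rw [Finset.sum_comm]
    exact Finset.sum_congr rfl fun b _ => Finset.sum_congr rfl fun c _ => by ring
  show (∑ x, ∑ y, ∑ z, Polynomial.C (t y z x) * (C x a' * A y b' * B z c')).coeff j =
    if j = h then s b' c' a' else 0
  rw [key]
  exact hd b' c' a' j hj

/-- `P` is invariant under the cyclic permutation of its factors. [folklore] -/
theorem sThree_cyc (K : Type*) [CommRing K] : (fun a b c => sThree K b c a) = sThree K := by
  have hInt : ∀ a b c, sThreeInt b c a = sThreeInt a b c := by decide
  funext a b c
  simp only [sThree, hInt a b c]

/-- **`P ⊵ N₁₁` over any field with `2 ≠ 0`** (through `T₂`, multipliers `2` and `2`).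
[cite: Nurmiev2000, Table 2] -/
theorem sThree_polyDegeneratesTo_nurmiev_11_of_two_ne_zero (K : Type*) [Field K] (h2 : (2 : K) ≠ 0) :
    PolyDegeneratesTo (sThree K) (nurmiev K 11) := by
  have hD2 : IsUnit (((2 : ℤ) : K)) := by
    rw [Int.cast_ofNat]
    exact isUnit_iff_ne_zero.mpr h2
  have h1 := polyDegeneratesTo_cyc (sThree_polyDegeneratesTo_tTwo K h2)
  rw [sThree_cyc] at h1
  exact h1.trans (DegenCert.polyDegeneratesTo_of_check K tTwo_iso_nurmiev_11_check hD2)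

/-- `N₁₀ ⊵ N₁₃` over every commutative ring: order `0`, multiplier `1`, the toric weight `ε` on the
third basis vector of the first factor kills the cell `e₂₀₀`. [cite: Nurmiev2000, Table 2] -/
theorem nurmiev_10_nurmiev_13_check :
    DegenCert.check 3 3 3 3 3 3 0 1 (nurmievInt 10) (nurmievInt 13)
      ![![[1], [], []], ![[], [1], []], ![[], [], [0, 1]]]
      ![![[1], [], []], ![[], [1], []], ![[], [], [1]]]
      ![![[1], [], []], ![[], [1], []], ![[], [], [1]]] = true := by
  decide +kernel

/-- **`N₁₀ ⊵ N₁₃` over every commutative ring.** [cite: Nurmiev2000, Table 2] -/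
theorem nurmiev_10_polyDegeneratesTo_nurmiev_13 (K : Type*) [CommRing K] :
    PolyDegeneratesTo (nurmiev K 10) (nurmiev K 13) :=
  DegenCert.polyDegeneratesTo_of_check_one K nurmiev_10_nurmiev_13_check

/-- **`P ⊵ N₁₃` over any field with `2 ≠ 0`** (through `N₁₀`, multipliers `4` and `1`).
[cite: Nurmiev2000, Table 2] -/
theorem sThree_polyDegeneratesTo_nurmiev_13_of_two_ne_zero (K : Type*) [Field K] (h2 : (2 : K) ≠ 0) :
    PolyDegeneratesTo (sThree K) (nurmiev K 13) :=
  (sThree_polyDegeneratesTo_nurmiev_of_two_ne_zero K h2 10 (by simp)).trans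
    (nurmiev_10_polyDegeneratesTo_nurmiev_13 K)

/-- `N₉ ⊵ N₁₈` as a RESTRICTION (order `0`, multiplier `1`): first factor the identity, second factor
`eᵢ ↦ uᵢ = (e₀, e₀ + e₁, e₁)`, third factor `eᵢ ↦ vᵢ = (e₀ - e₁, e₁, e₂ - e₁)`. [cite: Nurmiev2000, Table 2] -/
theorem nurmiev_9_nurmiev_18_check :
    DegenCert.check 3 3 3 3 3 3 0 1 (nurmievInt 9) (nurmievInt 18)
      ![![[1], [], []], ![[], [1], []], ![[], [], []]]
      ![![[1], [], []], ![[1], [1], []], ![[], [1], []]]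
      ![![[1], [-1], []], ![[], [1], []], ![[], [-1], [1]]] = true := by
  decide +kernel

/-- **`N₉ ⊵ N₁₈` over every commutative ring** (`N₁₈` lies in the concise space `K² ⊗ K³ ⊗ K³` of the
generic pencil `N₉`; here by an explicit rank-`3` restriction). [cite: Nurmiev2000, Table 2] -/
theorem nurmiev_9_polyDegeneratesTo_nurmiev_18 (K : Type*) [CommRing K] :
    PolyDegeneratesTo (nurmiev K 9) (nurmiev K 18) :=
  DegenCert.polyDegeneratesTo_of_check_one K nurmiev_9_nurmiev_18_check

/-- **`P ⊵ N₁₈` over any field with `2 ≠ 0`** (through `N₉`, multipliers `4` and `1`; the landed direct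
certificate had multiplier `250`). [cite: Nurmiev2000, Table 2] -/
theorem sThree_polyDegeneratesTo_nurmiev_18_of_two_ne_zero (K : Type*) [Field K] (h2 : (2 : K) ≠ 0) :
    PolyDegeneratesTo (sThree K) (nurmiev K 18) :=
  ((CayleyOmega.sThree_polyDegeneratesTo_nurmiev_nine_iff K).mpr h2).trans
    (nurmiev_9_polyDegeneratesTo_nurmiev_18 K)

/-- `P ⊵ 2·N₃` at order `1` (monomial toric certificate: weights `(0,0,1), (0,0,1), (0,1,1)`; the
generic boundary class, formerly reached only through `L ≅ N₃` with multiplier `48`).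
[cite: Nurmiev2000, Table 2] -/
theorem sThree_nurmiev_3_twoPower_check :
    DegenCert.check 3 3 3 3 3 3 1 2 sThreeInt (nurmievInt 3)
      ![![[1], [-1], [0, 1]], ![[1], [1], [0, -1]], ![[1], [], [0, 1]]]
      ![![[1], [1], []], ![[1], [-1], [0, 2]], ![[-1], [], []]]
      ![![[1], [0, -2], [0, -1]], ![[1], [], [0, -1]], ![[], [], [0, 1]]] = true := by
  decide +kernel

/-- `P ⊵ 2·N₅` at order `2` (monomial toric certificate: weights `(0,1,2), (0,1,2), (0,0,2)`; formerly
multiplier `24` through `L` and the algebra `B_{0,3}`). [cite: Nurmiev2000, Table 2] -/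
theorem sThree_nurmiev_5_twoPower_check :
    DegenCert.check 3 3 3 3 3 3 2 2 sThreeInt (nurmievInt 5)
      ![![[], [0, -1], [0, 0, -1]], ![[1], [], [0, 0, 1]], ![[1], [0, 1], []]]
      ![![[1], [0, 1], [0, 0, -1]], ![[], [0, 1], [0, 0, 1]], ![[1], [], []]]
      ![![[1], [1], [0, 0, 1]], ![[], [-1], [0, 0, 1]], ![[-1], [], []]] = true := by
  decide +kernel

/-- `N₅ ⊵ N₈` at order `2` with multiplier `1`, every commutative ring (the tensor shadow of the algebra
degeneration `B_{0,μ} → ℂ × ℂ[t]/t²`, on the normal forms). [cite: Nurmiev2000, Table 2] -/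
theorem nurmiev_5_nurmiev_8_check :
    DegenCert.check 3 3 3 3 3 3 2 1 (nurmievInt 5) (nurmievInt 8)
      ![![[-1], [], []], ![[], [1], []], ![[1], [], [0, 0, 1]]]
      ![![[-1], [0, 1], []], ![[], [0, -1], [0, 0, -1]], ![[], [], [0, 0, 1]]]
      ![![[], [0, -1], [0, 0, -1]], ![[-1], [0, 1], [0, 0, -1]], ![[-1], [0, 1], []]] = true := by
  decide +kernel

/-- **`N₅ ⊵ N₈` over every commutative ring.** [cite: Nurmiev2000, Table 2] -/
theorem nurmiev_5_polyDegeneratesTo_nurmiev_8 (K : Type*) [CommRing K] :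
    PolyDegeneratesTo (nurmiev K 5) (nurmiev K 8) :=
  DegenCert.polyDegeneratesTo_of_check_one K nurmiev_5_nurmiev_8_check

/-- **`P ⊵ N₃, N₅, N₈` over any field with `2 ≠ 0`** — in particular in characteristic `3`, where the
landed certificates (multipliers `48, 24, 6`) were silent. [cite: Nurmiev2000, Table 2] -/
theorem sThree_polyDegeneratesTo_nurmiev_of_two_ne_zero' (K : Type*) [Field K] (h2 : (2 : K) ≠ 0)
    (k : ℕ) (hk : k ∈ ({3, 5, 8} : Finset ℕ)) : PolyDegeneratesTo (sThree K) (nurmiev K k) := by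
  have hD2 : IsUnit (((2 : ℤ) : K)) := by
    rw [Int.cast_ofNat]
    exact isUnit_iff_ne_zero.mpr h2
  simp only [Finset.mem_insert, Finset.mem_singleton] at hk
  rcases hk with rfl | rfl | rfl
  · exact DegenCert.polyDegeneratesTo_of_check K sThree_nurmiev_3_twoPower_check hD2
  · exact DegenCert.polyDegeneratesTo_of_check K sThree_nurmiev_5_twoPower_check hD2
  · exact (DegenCert.polyDegeneratesTo_of_check K sThree_nurmiev_5_twoPower_check hD2).trans
      (nurmiev_5_polyDegeneratesTo_nurmiev_8 K)

/-- **FIFTEEN CLASSES WITH `P ⊵ N_k ⟺ char K ≠ 2`** over a field `K`: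
`k ∈ {3, 5, 6, 7, 8, 9, 10, 11, 12, 13, 14, 15, 16, 18, 22}`. [cite: Nurmiev2000, Table 2] -/
theorem sThree_polyDegeneratesTo_nurmiev_iff_two_ne_zero_of_mem (K : Type*) [Field K] (k : ℕ)
    (hk : k ∈ ({3, 5, 6, 7, 8, 9, 10, 11, 12, 13, 14, 15, 16, 18, 22} : Finset ℕ)) :
    PolyDegeneratesTo (sThree K) (nurmiev K k) ↔ (2 : K) ≠ 0 := by
  simp only [Finset.mem_insert, Finset.mem_singleton] at hk
  rcases hk with rfl | rfl | rfl | rfl | rfl | rfl | rfl | rfl | rfl | rfl | rfl | rfl | rfl | rfl | rfl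
  · exact ⟨fun h h2 => not_sThree_polyDegeneratesTo_nurmiev_of_mem_of_two_eq_zero K h2 3 (by simp) h,
      fun h2 => sThree_polyDegeneratesTo_nurmiev_of_two_ne_zero' K h2 3 (by simp)⟩
  · exact ⟨fun h h2 => not_sThree_polyDegeneratesTo_nurmiev_of_mem_of_two_eq_zero K h2 5 (by simp) h,
      fun h2 => sThree_polyDegeneratesTo_nurmiev_of_two_ne_zero' K h2 5 (by simp)⟩
  · exact sThree_polyDegeneratesTo_nurmiev_iff_two_ne_zero K 6 (by simp)
  · exact sThree_polyDegeneratesTo_nurmiev_iff_two_ne_zero K 7 (by simp)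
  · exact ⟨fun h h2 => not_sThree_polyDegeneratesTo_nurmiev_of_mem_of_two_eq_zero K h2 8 (by simp) h,
      fun h2 => sThree_polyDegeneratesTo_nurmiev_of_two_ne_zero' K h2 8 (by simp)⟩
  · exact CayleyOmega.sThree_polyDegeneratesTo_nurmiev_nine_iff K
  · exact sThree_polyDegeneratesTo_nurmiev_iff_two_ne_zero K 10 (by simp)
  · exact ⟨fun h h2 => not_sThree_polyDegeneratesTo_nurmiev_of_mem_of_two_eq_zero K h2 11 (by simp) h,
      sThree_polyDegeneratesTo_nurmiev_11_of_two_ne_zero K⟩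
  · exact sThree_polyDegeneratesTo_nurmiev_iff_two_ne_zero K 12 (by simp)
  · exact ⟨fun h h2 => not_sThree_polyDegeneratesTo_nurmiev_of_mem_of_two_eq_zero K h2 13 (by simp) h,
      sThree_polyDegeneratesTo_nurmiev_13_of_two_ne_zero K⟩
  · exact sThree_polyDegeneratesTo_nurmiev_iff_two_ne_zero K 14 (by simp)
  · exact sThree_polyDegeneratesTo_nurmiev_iff_two_ne_zero K 15 (by simp)
  · exact sThree_polyDegeneratesTo_nurmiev_iff_two_ne_zero K 16 (by simp)
  · exact ⟨fun h h2 => CayleyOmega.not_sThree_polyDegeneratesTo_nurmiev_eighteen_of_two K h2 h,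
      sThree_polyDegeneratesTo_nurmiev_18_of_two_ne_zero K⟩
  · exact sThree_polyDegeneratesTo_nurmiev_iff_two_ne_zero K 22 (by simp)

/-- **THE EVERY-FIELD TABLE (complete).**  Over a field `K` and for `1 ≤ k ≤ 24`:
`P ⊵ N_k` iff (`k ∉ {1, 2, 4}` and (`(2 : K) ≠ 0` or `k ∈ {17, 19, 20, 21, 23, 24}`)).
[cite: Nurmiev2000, Table 2] -/
theorem sThree_polyDegeneratesTo_nurmiev_iff (K : Type*) [Field K] {k : ℕ} (hk₁ : 1 ≤ k)
    (hk₂ : k ≤ 24) :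
    PolyDegeneratesTo (sThree K) (nurmiev K k) ↔
      (k ∉ ({1, 2, 4} : Finset ℕ) ∧ ((2 : K) ≠ 0 ∨ k ∈ ({17, 19, 20, 21, 23, 24} : Finset ℕ))) := by
  simp only [Finset.mem_insert, Finset.mem_singleton]
  by_cases hA : k ∈ ({17, 19, 20, 21, 23, 24} : Finset ℕ)
  · have hyes : PolyDegeneratesTo (sThree K) (nurmiev K k) := by
      by_cases hR : k ∈ ({17, 20, 21} : Finset ℕ)
      · exact sThree_polyDegeneratesTo_nurmiev_of_mem_restriction K k hR
      · refine sThree_polyDegeneratesTo_nurmiev_of_mem_all_rings K k ?_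
        simp only [Finset.mem_insert, Finset.mem_singleton] at hA hR ⊢
        omega
    simp only [Finset.mem_insert, Finset.mem_singleton] at hA
    constructor
    · intro _; refine ⟨by omega, Or.inr hA⟩
    · intro _; exact hyes
  · simp only [Finset.mem_insert, Finset.mem_singleton] at hA
    by_cases hB : k ∈ ({1, 2, 4} : Finset ℕ)
    · simp only [Finset.mem_insert, Finset.mem_singleton] at hB
      constructor
      · intro h
        rcases hB with rfl | rfl | rfl
        · exact absurd h (CayleyOmega.not_sThree_polyDegeneratesTo_nurmiev_one K)
        · exact absurd h (CayleyOmega.not_sThree_polyDegeneratesTo_nurmiev_two K)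
        · exact absurd h (CayleyOmega.not_sThree_polyDegeneratesTo_nurmiev_four K)
      · rintro ⟨h, _⟩; omega
    · simp only [Finset.mem_insert, Finset.mem_singleton] at hB
      have hC : k ∈ ({3, 5, 6, 7, 8, 9, 10, 11, 12, 13, 14, 15, 16, 18, 22} : Finset ℕ) := by
        simp only [Finset.mem_insert, Finset.mem_singleton]; omega
      rw [sThree_polyDegeneratesTo_nurmiev_iff_two_ne_zero_of_mem K k hC]
      constructor
      · intro h2; exact ⟨by omega, Or.inl h2⟩
      · rintro ⟨_, h2 | h17⟩
        · exact h2
        · omega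

/-- **Characteristic not `2`: the census is the complex one.**  Over a field with `2 ≠ 0` and for
`1 ≤ k ≤ 24`: `P ⊵ N_k ⟺ k ∉ {1, 2, 4}`. [cite: Nurmiev2000, Table 2] -/
theorem sThree_polyDegeneratesTo_nurmiev_iff_of_two_ne_zero (K : Type*) [Field K] (h2 : (2 : K) ≠ 0)
    {k : ℕ} (hk₁ : 1 ≤ k) (hk₂ : k ≤ 24) :
    PolyDegeneratesTo (sThree K) (nurmiev K k) ↔ k ∉ ({1, 2, 4} : Finset ℕ) := by
  rw [sThree_polyDegeneratesTo_nurmiev_iff K hk₁ hk₂]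
  exact ⟨fun h => h.1, fun h => ⟨h, Or.inl h2⟩⟩

/-- **Characteristic `2`: six classes.**  Over a field with `2 = 0` and for `1 ≤ k ≤ 24`:
`P ⊵ N_k ⟺ k ∈ {17, 19, 20, 21, 23, 24}`. [cite: Nurmiev2000, Table 2] -/
theorem sThree_polyDegeneratesTo_nurmiev_iff_of_two_eq_zero (K : Type*) [Field K] (h2 : (2 : K) = 0)
    {k : ℕ} (hk₁ : 1 ≤ k) (hk₂ : k ≤ 24) :
    PolyDegeneratesTo (sThree K) (nurmiev K k) ↔ k ∈ ({17, 19, 20, 21, 23, 24} : Finset ℕ) := by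
  rw [sThree_polyDegeneratesTo_nurmiev_iff K hk₁ hk₂]
  simp only [Finset.mem_insert, Finset.mem_singleton]
  constructor
  · rintro ⟨_, h | h⟩
    · exact absurd h2 h
    · exact h
  · intro h; exact ⟨by omega, Or.inr h⟩

end Summit.MatrixMultiplication.MatrixMultiplication.Theorems
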